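import Literature.Geometry.Kaehler.DolbeaultLerayBanach
import Literature.Analysis.OperatorTheory.SchwartzFiniteness
import HarnessLib

/-!
# The Cartan–Serre finiteness theorem: `dim H^{p,q}_{∂̄}(M) < ∞` for compact complex manifolds

Discharge of the named fact `Literature.NumberTheory.Transcendental.finite_dolbeaultCohomology`
(`Literature/NumberTheory/Transcendental/Dolbeault.lean`): on a compact Hausdorff complex manifold
modelled on a finite-dimensional `E`, every Dolbeault group `H^{p,q}_{∂̄}(M)` is finite-dimensional
— H. Cartan, J.-P. Serre, *Un théorème de finitude concernant les variétés analytiques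
compactes*, C. R. Acad. Sci. Paris **237** (1953) 128–130, in the organisation of H. Grauert,
R. Remmert, *Theorie der Steinschen Räume* (1977), Kap. VI §4 (finiteness for the coherent sheaf
`Ω^p` on the compact complex space `M`):

1. (`DolbeaultLerayBanach`) nested finite Leray covers `𝔘₀ ≪ 𝔘₁ ≪ 𝔘₂ ≪ 𝔘₃` by chart-convex
   sets, all of whose levels compute `H^{p,q}_{∂̄}(M) ≅ H^q(𝔘_l, Ω^p)` compatibly with restriction
   (Čech–Dolbeault double complex + `∂̄`-Poincaré lemma on convex chart sets), the Banach spaces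
   of bounded holomorphic cochains / cocycles, restriction compact (Montel), `δ` bounded;
2. (`SchwartzFiniteness`) L. Schwartz's abstract finiteness theorem
   `Module.finite_of_compact_restriction`: compact `r₁ : X → Y`, `r₂ : Y → V`, `d : W → V` with
   `r₂ r₁ X + d W ⊇ r₂ Y`, a class map killing `d W` whose every value is attained on `r₂ Y`;
3. here: `X, Y, V` = bounded `q`-cocycles of levels `2, 1, 0`, `W` = bounded `(q-1)`-cochains of
   level `0` (`0` for `q = 0`), `r₁, r₂` = restriction, `d = δ`, class map through the Leray
   isomorphism of level `0`; the hypotheses are `isCompactOperator_resZ`,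
   `exists_resZ_resZ_eq_add_deltaZ` / `exists_resZ_resZ_eq`, `cls_deltaZ`, `exists_cls_resZ_eq`.

Main results: `DolbeaultLerayDatum.finite_cohomology` and
**`finite_dolbeaultCohomology_holds : finite_dolbeaultCohomology`**.

## References

* H. Cartan, J.-P. Serre, C. R. Acad. Sci. Paris 237 (1953) 128–130. [CartanSerre1953]
* H. Grauert, R. Remmert, *Theorie der Steinschen Räume* (1977), Kap. VI §4. [GrauertRemmert1977]
* C. Voisin, *Hodge Theory and Complex Algebraic Geometry I* (2002), Cor. 5.25 (the statement).
  [VoisinHodgeI2002]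
-/

noncomputable section

open scoped Manifold ContDiff Topology
open Set Filter Function Literature.Geometry.Kaehler Literature.Algebra.Homology Literature.Analysis.OperatorTheory

namespace Literature.NumberTheory.Transcendental

variable {E : Type*} [NormedAddCommGroup E] [NormedSpace ℂ E]
  {M : Type*} [TopologicalSpace M] [ChartedSpace E M]

/-- **Finiteness of the Dolbeault cohomology computed by the global Dolbeault complex**, for a
compact Hausdorff complex manifold carrying a nested Leray datum (Cartan–Serre (1953) /
Grauert–Remmert (1977), Kap. VI §4.3, Endlichkeitssatz, via Schwartz's theorem
`Module.finite_of_compact_restriction`). [cite: GrauertRemmert1977, Kap. VI §4.3] -/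
theorem _root_.Literature.Geometry.Kaehler.DolbeaultLerayDatum.finite_cohomology [FiniteDimensional ℂ E]
    [T2Space M] [CompactSpace M] [IsManifold 𝓘(ℂ, E) ω M] [IsManifold 𝓘(ℝ, E) ∞ M]
    (D : DolbeaultLerayDatum E M) (p q : ℕ) :
    Module.Finite ℂ (NatCochain.Cohomology (R := ℂ)
      (fun b ↦ localDbar E M (isOpen_univ : IsOpen (univ : Set M)) p b) q) := by
  have h01 : (0 : Fin 4) < 1 := by decide
  have h12 : (1 : Fin 4) < 2 := by decide
  have h23 : (2 : Fin 4) < 3 := by decide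
  cases q with
  | zero =>
    refine Module.finite_of_compact_restriction (D.resZ p h12 h23 0) (D.resZ p h01 h12 0)
      (0 : D.Bdd p 0 0 →L[ℂ] ↥(D.Zb p h01 0)) (D.isCompactOperator_resZ p h12 h23 0) (fun y ↦ ?_)
      (D.cls p h01 0) (fun w ↦ by rw [show (0 : D.Bdd p 0 0 →L[ℂ] ↥(D.Zb p h01 0)) w = 0 from rfl, map_zero])
      (D.exists_cls_resZ_eq p h01 h12 0)
    obtain ⟨x, hx⟩ := D.exists_resZ_resZ_eq p h01 h12 h23 y
    exact ⟨x, 0, by rw [map_zero, add_zero]; exact hx⟩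
  | succ k =>
    exact Module.finite_of_compact_restriction (D.resZ p h12 h23 (k + 1)) (D.resZ p h01 h12 (k + 1))
      (D.deltaZ p h01 k) (D.isCompactOperator_resZ p h12 h23 (k + 1))
      (D.exists_resZ_resZ_eq_add_deltaZ p h01 h12 h23 k) (D.cls p h01 (k + 1)) (D.cls_deltaZ p h01 k)
      (D.exists_cls_resZ_eq p h01 h12 (k + 1))

/-- **The Cartan–Serre finiteness theorem** (discharge of `finite_dolbeaultCohomology`): on a
compact Hausdorff complex manifold the Dolbeault cohomology groups `H^{p,q}_{∂̄}(M)` are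
finite-dimensional. H. Cartan, J.-P. Serre (1953); Grauert–Remmert (1977), Kap. VI §4; Voisin
(2002), Cor. 5.25. [cite: CartanSerre1953] -/
theorem finite_dolbeaultCohomology_holds [IsManifold 𝓘(ℂ, E) ω M] [IsManifold 𝓘(ℝ, E) ∞ M] :
    finite_dolbeaultCohomology (E := E) (M := M) := by
  intro _ _ _ p q
  obtain ⟨D⟩ := nonempty_dolbeaultLerayDatum (E := E) (M := M)
  obtain ⟨e⟩ := nonempty_cohomology_equiv_dolbeaultCohomology (E := E) (M := M) p q
  haveI := D.finite_cohomology p q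
  exact Module.Finite.equiv e

end Literature.NumberTheory.Transcendental

end
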